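import Summits.QuantumFields.YangMills.Theorems.BalabanLadderNTMarkovMirrorBoxFloorPackage
import Summits.QuantumFields.YangMills.Theorems.BalabanLadderUVSeamRecFloorsEngineOfResponseMoments
import HarnessLib

/-!
# Crux `UVSeamRec` (stmt-QuantumFields-20043), stub `stub_floorsEngine` (S-B): the CHECK-LEMMA from {(RM), scalable box-form
# bare mirror floors} — no cube bookkeeping

Helper file (`--supports stmt-QuantumFields-20043 --as helper`; fleet lead prover of crux `NT`, unit `ym-spine-19353-p1`, g22) — the
`…UVSeamRecFloorsEngineOfResponseMoments` CHECK-LEMMA `stubFloorsEngine_of_bareFloor_and_responseMoments_rF` with its floors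
hypothesis SIMPLIFIED: instead of a positive-time cube family `(c β, b β)` with five bookkeeping clauses and (MF) on cube-carried
smearings, the supplier gives, for every femto radius `ℓ > 0`, ONE test function `v` with `tsupport v ⊆ {y₀ > 0} ∩ B(0, ℓ)` carrying
the bare mirror floor in the route form of `StaticSourceWitness` / `FiniteRankMirror`,
`9ε/4 ≤ E_T[(Ṽ_box∘Θ₀)·Ṽ_box] − E_T[Ṽ_box]²` on the tori `Λ₅ ≤ aβ·L` — the cubes are constructed
(`FiniteRankMirrorDefectPeeling.cubePackage_of_boxFloor`, femto side `≤ 5ℓ`).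

* `stubFloorsEngine_of_boxBareFloor_and_responseMoments_rF` — (RM) verbatim (hypothesis of p532738) + {unit `a > 0` with
  `a β / uRec β → c₀ > 0`; SCALABLE box-form bare mirror floors; the three-point conjunct} ⇒ the statement of the registered
  `UVSeamRec.stub_floorsEngine`.

HONEST FRAMING: kernel-checked implication on a CONDITIONAL chain; (RM) is an OPEN RG statement (E0′-K with background), the bare mirror
floors and clause (ii) are crux `NT`'s open mathematics (barrier `PerturbativeInvisibility`); nothing of UVSeamRec / NT / the mass gap is
proved here; not Clay.
-/

set_option autoImplicit false

noncomputable section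

open scoped SchwartzMap
open MeasureTheory Filter Topology
open Literature.MathematicalPhysics.QuantumFieldTheory Literature.MathematicalPhysics.QuantumLattice
open Literature.Probability.LatticeModels
open Summit.QuantumFields.YangMills.Cruxes.OSLegsFromFemtoAndGap.DlrCollarTransfer
open Summit.QuantumFields.YangMills.Cruxes.FiniteRankMirrorDefectPeeling (cubePackage_of_boxFloor)

namespace Summit.QuantumFields.YangMills.Cruxes.UVSeamRec.MarkovMirrorFloors

/-- **CHECK-LEMMA (box-floor form): the REGISTERED `stub_floorsEngine` statement from the verbatim (RM) hypothesis of p532738 and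
SCALABLE box-form bare mirror floors at `rF`.**  `hRM` as in `stubFloorsEngine_of_bareFloor_and_responseMoments_rF`; `hF` = a unit
`a > 0` with `a β / uRec β → c₀ > 0`, and for EVERY radius `ℓ > 0` ONE test function `v` with `tsupport v ⊆ {y₀ > 0} ∩ B(0, ℓ)`, `ε > 0`
and the floor `9ε/4 ≤ E_T[(Ṽ_box∘Θ₀)·Ṽ_box] − E_T[Ṽ_box]²` for `β ≥ β₅` on every torus `Λ₅ ≤ aβ·L` (no cube data), plus any supplier
of the three-point conjunct.  Mechanism: at range `ℓ` take the supplier's `v` at radius `ℓ/5`; `cubePackage_of_boxFloor` builds the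
cube family with femto side `≤ ℓ` and (MF) in cube form; then `stubFloorsEngine_of_bareFloor_and_responseMoments_rF`. [folklore] -/
theorem stubFloorsEngine_of_boxBareFloor_and_responseMoments_rF
    (hRM : letI : MeasurableSpace (Matrix.specialUnitaryGroup (Fin 2) ℂ) := borel _
      haveI : BorelSpace (Matrix.specialUnitaryGroup (Fin 2) ℂ) := ⟨rfl⟩
      ∃ (a : ℝ → ℝ) (c : ℝ) (C₁ B β₁ ℓ₁ P₀ : ℝ) (p : Fin 4 × Fin 4 → ℝ → ℝ), 0 < c ∧
        (∀ᶠ β in atTop, a β ≤ c * Transport.uRec β) ∧ 0 < ℓ₁ ∧ 0 < C₁ ∧ (∀ q β, |p q β| ≤ P₀) ∧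
        ∀ β : ℝ, β₁ ≤ β → ∀ (L n : ℕ) (q : Fin n → Fin 4 × Fin 4) (x : Fin n → (Fin 4 → ℤ)) (R : ℕ),
          (∀ i, (q i).1 < (q i).2) → 1 ≤ R → (R : ℝ) * a β ≤ ℓ₁ → 4 * R + 8 ≤ L →
          (∀ i j : Fin n, i ≠ j → ∃ k : Fin 4,
            (2 * (R : ℤ) + 4) ≤ |((((x i k - x j k : ℤ) : ZMod (2 * L + 1))).valMinAbs : ℤ)|) →
          ∀ T : Finset (Fin n),
            torusE (Matrix.specialUnitaryGroup (Fin 2) ℂ) (fundamentalLatticeRep 2) β L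
              (fun U => Real.exp (∑ i ∈ T, (R : ℝ) ^ 4 / C₁ *
                |kerE (Matrix.specialUnitaryGroup (Fin 2) ℂ) (fundamentalLatticeRep 2) β
                  (fun k => x i k - (R + 1)) (2 * R + 3) U
                  (plane (Matrix.specialUnitaryGroup (Fin 2) ℂ) (fundamentalLatticeRep 2) (q i) (x i)) -
                  p (q i) β|)) ≤ Real.exp (B * T.card))
    (hF : letI : MeasurableSpace (Matrix.specialUnitaryGroup (Fin 2) ℂ) := borel _
      haveI : BorelSpace (Matrix.specialUnitaryGroup (Fin 2) ℂ) := ⟨rfl⟩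
      ∃ (a : ℝ → ℝ) (c₀ : ℝ), 0 < c₀ ∧ (∀ β, 0 < a β) ∧
        Tendsto (fun β => a β / Transport.uRec β) atTop (𝓝 c₀) ∧
      (∀ ℓ : ℝ, 0 < ℓ →
        ∃ (v : 𝓢(EuclideanSpace ℝ (Fin 4), ℝ)) (ε β₅ Λ₅ : ℝ),
          tsupport (v : EuclideanSpace ℝ (Fin 4) → ℝ) ⊆ {y | 0 < y 0} ∧
          tsupport (v : EuclideanSpace ℝ (Fin 4) → ℝ) ⊆ Metric.closedBall 0 ℓ ∧ 0 < ε ∧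
          (∀ β, β₅ ≤ β → ∀ L : ℕ, Λ₅ ≤ a β * L →
            9 * ε / 4 ≤ torusE (Matrix.specialUnitaryGroup (Fin 2) ℂ) (fundamentalLatticeRep 2) β L (fun V =>
                (∑ y ∈ box 4 L, v (a β • siteToE y) *
                    dens (Matrix.specialUnitaryGroup (Fin 2) ℂ) (fundamentalLatticeRep 2) y (cfgReflect V)) *
                  ∑ y ∈ box 4 L, v (a β • siteToE y) *
                    dens (Matrix.specialUnitaryGroup (Fin 2) ℂ) (fundamentalLatticeRep 2) y V) -
              torusE (Matrix.specialUnitaryGroup (Fin 2) ℂ) (fundamentalLatticeRep 2) β L (fun V =>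
                  ∑ y ∈ box 4 L, v (a β • siteToE y) *
                    dens (Matrix.specialUnitaryGroup (Fin 2) ℂ) (fundamentalLatticeRep 2) y V) ^ 2)) ∧
      (∃ (f g h : 𝓢(EuclideanSpace ℝ (Fin 4), ℝ)) (ε β₅ Λ₅ : ℝ),
        HasCompactSupport (f : EuclideanSpace ℝ (Fin 4) → ℝ) ∧
        HasCompactSupport (g : EuclideanSpace ℝ (Fin 4) → ℝ) ∧
        HasCompactSupport (h : EuclideanSpace ℝ (Fin 4) → ℝ) ∧
        Disjoint (tsupport (f : EuclideanSpace ℝ (Fin 4) → ℝ)) (tsupport (g : EuclideanSpace ℝ (Fin 4) → ℝ)) ∧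
        Disjoint (tsupport (g : EuclideanSpace ℝ (Fin 4) → ℝ)) (tsupport (h : EuclideanSpace ℝ (Fin 4) → ℝ)) ∧
        Disjoint (tsupport (f : EuclideanSpace ℝ (Fin 4) → ℝ)) (tsupport (h : EuclideanSpace ℝ (Fin 4) → ℝ)) ∧
        0 < ε ∧ ∀ β : ℝ, β₅ ≤ β → ∀ L : ℕ, Λ₅ ≤ a β * L →
          ε ≤ |Q3 (Matrix.specialUnitaryGroup (Fin 2) ℂ) (fundamentalLatticeRep 2) β L (a β) f g h|)) :
    letI : MeasurableSpace (Matrix.specialUnitaryGroup (Fin 2) ℂ) := borel _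
    haveI : BorelSpace (Matrix.specialUnitaryGroup (Fin 2) ℂ) := ⟨rfl⟩
    ∃ (a : ℝ → ℝ) (c₀ : ℝ), 0 < c₀ ∧ (∀ β, 0 < a β) ∧
      Tendsto (fun β => a β / Transport.uRec β) atTop (𝓝 c₀) ∧
      (∃ (v : 𝓢(EuclideanSpace ℝ (Fin 4), ℝ)) (ε β₅ Λ₅ : ℝ),
        HasCompactSupport (v : EuclideanSpace ℝ (Fin 4) → ℝ) ∧
        tsupport (v : EuclideanSpace ℝ (Fin 4) → ℝ) ⊆ {y : EuclideanSpace ℝ (Fin 4) | 0 < y 0} ∧ 0 < ε ∧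
        ∀ β : ℝ, β₅ ≤ β → ∀ L : ℕ, Λ₅ ≤ a β * L →
          ε ≤ Q2 (Matrix.specialUnitaryGroup (Fin 2) ℂ) (fundamentalLatticeRep 2) β L (a β) (thetaTest 4 v) v) ∧
      (∃ (f g h : 𝓢(EuclideanSpace ℝ (Fin 4), ℝ)) (ε β₅ Λ₅ : ℝ),
        HasCompactSupport (f : EuclideanSpace ℝ (Fin 4) → ℝ) ∧
        HasCompactSupport (g : EuclideanSpace ℝ (Fin 4) → ℝ) ∧
        HasCompactSupport (h : EuclideanSpace ℝ (Fin 4) → ℝ) ∧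
        Disjoint (tsupport (f : EuclideanSpace ℝ (Fin 4) → ℝ)) (tsupport (g : EuclideanSpace ℝ (Fin 4) → ℝ)) ∧
        Disjoint (tsupport (g : EuclideanSpace ℝ (Fin 4) → ℝ)) (tsupport (h : EuclideanSpace ℝ (Fin 4) → ℝ)) ∧
        Disjoint (tsupport (f : EuclideanSpace ℝ (Fin 4) → ℝ)) (tsupport (h : EuclideanSpace ℝ (Fin 4) → ℝ)) ∧
        0 < ε ∧ ∀ β : ℝ, β₅ ≤ β → ∀ L : ℕ, Λ₅ ≤ a β * L →
          ε ≤ |Q3 (Matrix.specialUnitaryGroup (Fin 2) ℂ) (fundamentalLatticeRep 2) β L (a β) f g h|) := by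
  letI : MeasurableSpace (Matrix.specialUnitaryGroup (Fin 2) ℂ) := borel _
  haveI : BorelSpace (Matrix.specialUnitaryGroup (Fin 2) ℂ) := ⟨rfl⟩
  obtain ⟨a, c₀, hc₀, ha₀, hau, hscal, h3⟩ := hF
  have ha : Tendsto a atTop (𝓝 0) := ReferenceFloors.tendsto_zero_of_ratio hau
  refine stubFloorsEngine_of_bareFloor_and_responseMoments_rF hRM ⟨a, c₀, hc₀, ha₀, hau, fun ℓ hℓ => ?_, h3⟩
  obtain ⟨v, ε, β₅, Λ₅, hv0, hvB, hε, hMF⟩ := hscal (ℓ / 5) (by positivity)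
  obtain ⟨κ, β₆, Λ₆, c, b, hvK, hκ, hgeom, hfem, hsupp, hthick, hMFc⟩ :=
    cubePackage_of_boxFloor (Matrix.specialUnitaryGroup (Fin 2) ℂ) (fundamentalLatticeRep 2) a ha₀ ha v
      (by positivity : (0 : ℝ) < ℓ / 5) hv0 hvB hMF
  exact ⟨v, ε, β₆, Λ₆, κ, c, b, hvK, hv0, hε, hκ, hgeom, fun β hβ => by linarith [hfem β hβ], hsupp, hthick, hMFc⟩

end Summit.QuantumFields.YangMills.Cruxes.UVSeamRec.MarkovMirrorFloors

end
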